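import Summits.KontsevichZagierPeriods.Zeta5Search.Barrier.ConeGammaCuspSymmetric
import Summits.KontsevichZagierPeriods.Zeta5Search.Barrier.ConeGammaRegularCusp

/-!
# ζ(5) search — BARRIER: the symmetric part of the cusp slope over ONE PERIOD, and local maximisers of `γ`

HONEST FRAMING (cell `pub-zeta5`): systematic search; no irrationality claim unless kernel-certified. MODEL objects
under Brown–Zudilin's (28)+(30) accounting ([BZ22] = arXiv:2210.03391; (28) observed, not proved); nothing here is a
statement about `ζ(5)`, about any `γ` of record, about the cone's supremum over Regular directions (C2 = `BarrierC2`
OPEN) or about the SIGN of any cusp slope at any named direction; S-E stays CONJECTURED; records in print UNMOVED.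
Prover P2 g25, companion of `ConeGammaCuspSymmetric` (item (c) of P2 g23's successor list, lead's standing word lit
g37 INBOX l.9213; plan l.9221; ruling YES / GO l.9223).

With `σ = cuspSlope a T` (`ConeGammaLogCuspSlope`), the sorted breakpoints `b_0 = 0 < b_1 < ⋯ < b_{M−1} = T` of one
period (`bkpt a T m`, `M = (bkpts a T).card`) and the germ integrals `germR`, `germL` (`ConeGammaShiftGerms`):

* **`cuspSlope_add_cuspSlope_neg_eq`** — THE SYMMETRIC PART OVER ONE PERIOD: for all 28 forms positive, a period `T`
  and ONE admissible scale `ρ` (the hypotheses of `cuspSlope_eq_sum_germs`; the same `ρ` serves `δ` and `−δ` since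
  `clusterBound a (−δ) = clusterBound a δ`), `σ(δ) + σ(−δ) = E + Σ_{m < M−2} R_{m+1}` where
  `E = germR(δ)(0) + germL(δ)(T) + germR(−δ)(0) + germL(−δ)(T)` collects the four END germs (the lattice point) and
  `R_m = germR(δ)(b_m) + germL(δ)(b_m) + germR(−δ)(b_m) + germL(−δ)(b_m)` the four germs at the interior breakpoint
  `b_m` (re-indexing of the two germ sums; `bkpt_zero`, `bkpt_last`);
* **`endGerms_nonneg`** — `0 ≤ E` for EVERY `δ` (each of the four is `≥ 0`: `germR_zero_nonneg`, `germL_period_nonneg`);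
* **`cuspSlope_symm_nonneg_of_single_walls`** — if every interior breakpoint carries exactly ONE integral form, then
  `0 ≤ σ(δ) + σ(−δ)` for every `δ` (`germ_symm_eq_zero_of_single_wall` termwise), and then
  **`cuspSlope_eq_zero_of_single_walls_of_isLocalMax`**: at a Regular open-box local maximiser of `γ` with `Q > 0`
  such an orbit is CUSP-FREE, `σ(δ) = 0` for every `δ`;
* **`interior_symm_le_neg_endGerms_of_isLocalMax`**, **`interior_symm_nonpos_of_isLocalMax`** — COROLLARY with P2
  g23's `cuspSlope_nonpos_of_isLocalMax`: at a Regular open-box rational direction with `Q = C₁ + δ₂₈ − Φ > 0` that is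
  a local maximiser of `γ`, `Σ_{interior} R ≤ −E ≤ 0` for EVERY displacement `δ`: a cusp top needs interior
  MULTI-WALL junctions with negative reflection defect (`germ_symm_eq_integral_refl`) in every displacement direction;
  the lattice point and the single walls can never supply it.
READING: this is the kernel form of the desk answer to (c) (`HOME/pub-zeta5-p2/g25/alg/sympart.py`, exact rationals):
the symmetric part has NO fixed sign — the interior multi-wall junctions carry it (record/41 along `e₁`: `E = +0.109`,
interior `−1.249`; `t*` along `w`: `E = +0.067`, interior `+0.297`, in `S = σ/λ₀` units; DATA, not kernel). NOT here
(honest): the sign of `σ` or of any reflection defect at any named direction, any statement that a named direction is or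
is not a local maximiser, anything about C2, S-E, `ζ(5)`.
-/

noncomputable section

open Set MeasureTheory
open scoped Topology

namespace Summit.KontsevichZagierPeriods.Zeta5Search.Barrier.ConeGamma

/-! ### The symmetric part over one period -/

/-- Re-indexing of one germ sum: `Σ_{m<M−1} (germR(b_m) + germL(b_{m+1})) = germR(0) + germL(T) + Σ_{m<M−2}
(germR(b_{m+1}) + germL(b_{m+1}))` — the right germs at `b_0..b_{M−2}` and the left germs at `b_1..b_{M−1}` regrouped
by breakpoint, the two ends `b_0 = 0`, `b_{M−1} = T` set apart. -/
theorem sum_germs_reindex (a : Dir) {T : ℝ} (hT : 0 < T) (δ : Fin 8 → ℝ) (ρ : ℝ) :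
    ∑ m ∈ Finset.range ((bkpts a T).card - 1), (germR a δ ρ (bkpt a T m) + germL a δ ρ (bkpt a T (m + 1))) =
      germR a δ ρ 0 + germL a δ ρ T +
        ∑ m ∈ Finset.range ((bkpts a T).card - 2),
          (germR a δ ρ (bkpt a T (m + 1)) + germL a δ ρ (bkpt a T (m + 1))) := by
  have hc := two_le_card_bkpts a hT
  obtain ⟨M, hM⟩ : ∃ M : ℕ, (bkpts a T).card - 1 = M + 1 := ⟨(bkpts a T).card - 2, by omega⟩
  have hM2 : (bkpts a T).card - 2 = M := by omega
  rw [Finset.sum_add_distrib, hM, Finset.sum_range_succ' (fun m => germR a δ ρ (bkpt a T m)),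
    Finset.sum_range_succ (fun m => germL a δ ρ (bkpt a T (m + 1))), bkpt_zero a hT,
    show M + 1 = (bkpts a T).card - 1 by omega, bkpt_last a hT, hM2, Finset.sum_add_distrib]
  ring

/-- **THE SYMMETRIC PART OF THE CUSP SLOPE OVER ONE PERIOD.** For a direction with all 28 forms positive, a period
`T` of the forms, a displacement `δ` and ONE admissible scale `ρ` (`ρK < 1`, `ρK < wallDist`, `2ρW ≤` every
breakpoint gap — the hypotheses of `cuspSlope_eq_sum_germs`; they serve `−δ` as well):
`cuspSlope a T δ + cuspSlope a T (−δ) = [germR(δ)(0) + germL(δ)(T) + germR(−δ)(0) + germL(−δ)(T)]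
  + Σ_{m < M−2} [germR(δ) + germL(δ) + germR(−δ) + germL(−δ)](b_{m+1})` — END germs plus interior breakpoints. -/
theorem cuspSlope_add_cuspSlope_neg_eq {a : Dir} (hpos : ∀ k, 0 < h28 a k) {T : ℝ} (hT : 0 < T)
    (hper : ∀ k : Fin 28, ∃ z : ℤ, T * h28 a k = z) (δ : Fin 8 → ℝ) {ρ : ℝ} (hρ : 0 < ρ)
    (h1 : ρ * clusterBound a δ < 1) (h2 : ρ * clusterBound a δ < wallDist a T)
    (hgap : ∀ m, m + 1 < (bkpts a T).card → 2 * ρ * clusterWidth a δ ≤ bkpt a T (m + 1) - bkpt a T m) :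
    cuspSlope a T δ + cuspSlope a T (-δ) =
      (germR a δ ρ 0 + germL a δ ρ T + (germR a (-δ) ρ 0 + germL a (-δ) ρ T)) +
        ∑ m ∈ Finset.range ((bkpts a T).card - 2),
          (germR a δ ρ (bkpt a T (m + 1)) + germL a δ ρ (bkpt a T (m + 1)) +
            germR a (-δ) ρ (bkpt a T (m + 1)) + germL a (-δ) ρ (bkpt a T (m + 1))) := by
  have h1' : ρ * clusterBound a (-δ) < 1 := by rw [clusterBound_neg]; exact h1
  have h2' : ρ * clusterBound a (-δ) < wallDist a T := by rw [clusterBound_neg]; exact h2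
  have hgap' : ∀ m, m + 1 < (bkpts a T).card →
      2 * ρ * clusterWidth a (-δ) ≤ bkpt a T (m + 1) - bkpt a T m := fun m hm => by
    rw [clusterWidth_neg]; exact hgap m hm
  rw [cuspSlope_eq_sum_germs hpos hT hper δ hρ h1 h2 hgap, cuspSlope_eq_sum_germs hpos hT hper (-δ) hρ h1' h2' hgap',
    sum_germs_reindex a hT δ ρ, sum_germs_reindex a hT (-δ) ρ]
  have hs : ∑ m ∈ Finset.range ((bkpts a T).card - 2),
      (germR a δ ρ (bkpt a T (m + 1)) + germL a δ ρ (bkpt a T (m + 1)) +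
        germR a (-δ) ρ (bkpt a T (m + 1)) + germL a (-δ) ρ (bkpt a T (m + 1))) =
      ∑ m ∈ Finset.range ((bkpts a T).card - 2),
          (germR a δ ρ (bkpt a T (m + 1)) + germL a δ ρ (bkpt a T (m + 1))) +
        ∑ m ∈ Finset.range ((bkpts a T).card - 2),
          (germR a (-δ) ρ (bkpt a T (m + 1)) + germL a (-δ) ρ (bkpt a T (m + 1))) := by
    rw [← Finset.sum_add_distrib]
    exact Finset.sum_congr rfl fun m _ => by ring
  rw [hs]
  ring

/-- **The END germs are `≥ 0` for every displacement**: `0 ≤ germR(δ)(0) + germL(δ)(T) + germR(−δ)(0) + germL(−δ)(T)`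
(`0 ≤ ρ`, `ρK < 1`; each of the four is `≥ 0` by `germR_zero_nonneg` / `germL_period_nonneg`). -/
theorem endGerms_nonneg {a : Dir} (hpos : ∀ k, 0 < h28 a k) {T : ℝ}
    (hper : ∀ k : Fin 28, ∃ z : ℤ, T * h28 a k = z) (δ : Fin 8 → ℝ) {ρ : ℝ} (hρ : 0 ≤ ρ)
    (h1 : ρ * clusterBound a δ < 1) :
    0 ≤ germR a δ ρ 0 + germL a δ ρ T + (germR a (-δ) ρ 0 + germL a (-δ) ρ T) := by
  have h1' : ρ * clusterBound a (-δ) < 1 := by rw [clusterBound_neg]; exact h1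
  have e1 := germR_zero_nonneg hpos δ hρ h1
  have e2 := germL_period_nonneg hpos hper δ hρ h1
  have e3 := germR_zero_nonneg hpos (-δ) hρ h1'
  have e4 := germL_period_nonneg hpos hper (-δ) hρ h1'
  exact add_nonneg (add_nonneg e1 e2) (add_nonneg e3 e4)

/-! ### Orbits whose interior breakpoints are single walls -/

/-- **If every interior breakpoint carries exactly ONE integral form, the symmetric part is `≥ 0`**: the interior
sum vanishes termwise (`germ_symm_eq_zero_of_single_wall`) and the end germs are `≥ 0`. (A conditional statement: the
hypothesis is a property of the orbit; nothing here says which directions have it.) -/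
theorem cuspSlope_symm_nonneg_of_single_walls {a : Dir} (hpos : ∀ k, 0 < h28 a k) {T : ℝ} (hT : 0 < T)
    (hper : ∀ k : Fin 28, ∃ z : ℤ, T * h28 a k = z) (δ : Fin 8 → ℝ) {ρ : ℝ} (hρ : 0 < ρ)
    (h1 : ρ * clusterBound a δ < 1) (h2 : ρ * clusterBound a δ < wallDist a T)
    (hgap : ∀ m, m + 1 < (bkpts a T).card → 2 * ρ * clusterWidth a δ ≤ bkpt a T (m + 1) - bkpt a T m)
    (hsingle : ∀ m, m + 2 < (bkpts a T).card → ∃ k₀ : Fin 28, (∃ z : ℤ, bkpt a T (m + 1) * h28 a k₀ = z) ∧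
      ∀ k, k ≠ k₀ → ∀ z : ℤ, bkpt a T (m + 1) * h28 a k ≠ z) :
    0 ≤ cuspSlope a T δ + cuspSlope a T (-δ) := by
  rw [cuspSlope_add_cuspSlope_neg_eq hpos hT hper δ hρ h1 h2 hgap]
  have hint : ∑ m ∈ Finset.range ((bkpts a T).card - 2),
      (germR a δ ρ (bkpt a T (m + 1)) + germL a δ ρ (bkpt a T (m + 1)) +
        germR a (-δ) ρ (bkpt a T (m + 1)) + germL a (-δ) ρ (bkpt a T (m + 1))) = 0 := by
    refine Finset.sum_eq_zero fun m hm => ?_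
    have hm' : m + 2 < (bkpts a T).card := by
      have := Finset.mem_range.mp hm; omega
    obtain ⟨k₀, hk₀, hother⟩ := hsingle m hm'
    exact germ_symm_eq_zero_of_single_wall hpos (bkpt_mem (by omega)) hk₀ hother δ hρ h1 h2
  rw [hint, add_zero]
  exact endGerms_nonneg hpos hper δ hρ.le h1

/-! ### Local maximisers of `γ`: where a cusp top must come from -/

/-- **COROLLARY (with P2 g23's `cuspSlope_nonpos_of_isLocalMax`).** At a Regular OPEN-box direction whose 28 forms
have a period `T`, with `Q = C₁ + δ₂₈ − Φ > 0`, which is a LOCAL MAXIMISER of `γ`: for EVERY displacement `δ` and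
every admissible scale `ρ`, the interior symmetric part is `≤ −(end germs) ≤ 0`:
`Σ_{m<M−2} [germR(δ) + germL(δ) + germR(−δ) + germL(−δ)](b_{m+1}) ≤ −[the four end germs]`. A cusp top of `γ` must
be paid for by interior breakpoints — by `germ_symm_eq_zero_of_single_wall` only the MULTI-WALL ones can pay, through a
negative reflection defect (`germ_symm_eq_integral_refl`). -/
theorem interior_symm_le_neg_endGerms_of_isLocalMax {a : Dir}
    (hopen : ∀ j : Fin 7, 0 < sParam a j.succ ∧ sParam a j.succ < sParam a 0)
    {T : ℝ} (hT : 0 < T) (hper : ∀ k : Fin 28, ∃ z : ℤ, T * h28 a k = z) (δ : Fin 8 → ℝ)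
    (hQ : 0 < C1 a + delta28 a - phi30 a) (hreg : Regular a) (hmax : IsLocalMax gamma a) {ρ : ℝ} (hρ : 0 < ρ)
    (h1 : ρ * clusterBound a δ < 1) (h2 : ρ * clusterBound a δ < wallDist a T)
    (hgap : ∀ m, m + 1 < (bkpts a T).card → 2 * ρ * clusterWidth a δ ≤ bkpt a T (m + 1) - bkpt a T m) :
    ∑ m ∈ Finset.range ((bkpts a T).card - 2),
        (germR a δ ρ (bkpt a T (m + 1)) + germL a δ ρ (bkpt a T (m + 1)) +
          germR a (-δ) ρ (bkpt a T (m + 1)) + germL a (-δ) ρ (bkpt a T (m + 1))) ≤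
      -(germR a δ ρ 0 + germL a δ ρ T + (germR a (-δ) ρ 0 + germL a (-δ) ρ T)) := by
  have hpos := h28_pos_of_openBox hopen
  have e := cuspSlope_add_cuspSlope_neg_eq hpos hT hper δ hρ h1 h2 hgap
  have s1 := cuspSlope_nonpos_of_isLocalMax hopen hT hper δ hQ hreg hmax
  have s2 := cuspSlope_nonpos_of_isLocalMax hopen hT hper (-δ) hQ hreg hmax
  linarith

/-- **At a local maximiser of `γ` the interior symmetric part is `≤ 0` in every displacement direction** (the end
germs being `≥ 0`, `endGerms_nonneg`). -/
theorem interior_symm_nonpos_of_isLocalMax {a : Dir}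
    (hopen : ∀ j : Fin 7, 0 < sParam a j.succ ∧ sParam a j.succ < sParam a 0)
    {T : ℝ} (hT : 0 < T) (hper : ∀ k : Fin 28, ∃ z : ℤ, T * h28 a k = z) (δ : Fin 8 → ℝ)
    (hQ : 0 < C1 a + delta28 a - phi30 a) (hreg : Regular a) (hmax : IsLocalMax gamma a) {ρ : ℝ} (hρ : 0 < ρ)
    (h1 : ρ * clusterBound a δ < 1) (h2 : ρ * clusterBound a δ < wallDist a T)
    (hgap : ∀ m, m + 1 < (bkpts a T).card → 2 * ρ * clusterWidth a δ ≤ bkpt a T (m + 1) - bkpt a T m) :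
    ∑ m ∈ Finset.range ((bkpts a T).card - 2),
        (germR a δ ρ (bkpt a T (m + 1)) + germL a δ ρ (bkpt a T (m + 1)) +
          germR a (-δ) ρ (bkpt a T (m + 1)) + germL a (-δ) ρ (bkpt a T (m + 1))) ≤ 0 := by
  have hpos := h28_pos_of_openBox hopen
  have h := interior_symm_le_neg_endGerms_of_isLocalMax hopen hT hper δ hQ hreg hmax hρ h1 h2 hgap
  have hE := endGerms_nonneg hpos hper δ hρ.le h1
  linarith

/-- **A single-wall orbit can be a local maximiser of `γ` only if it is cusp-free**: at a Regular open-box direction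
with `Q > 0`, a period `T`, every interior breakpoint a single wall, and `a` a local maximiser of `γ`, EVERY cusp slope
vanishes: `cuspSlope a T δ = 0` (from `σ(δ) ≤ 0`, `σ(−δ) ≤ 0` and `σ(δ) + σ(−δ) ≥ 0`). -/
theorem cuspSlope_eq_zero_of_single_walls_of_isLocalMax {a : Dir}
    (hopen : ∀ j : Fin 7, 0 < sParam a j.succ ∧ sParam a j.succ < sParam a 0)
    {T : ℝ} (hT : 0 < T) (hper : ∀ k : Fin 28, ∃ z : ℤ, T * h28 a k = z) (δ : Fin 8 → ℝ)
    (hQ : 0 < C1 a + delta28 a - phi30 a) (hreg : Regular a) (hmax : IsLocalMax gamma a)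
    (hsingle : ∀ m, m + 2 < (bkpts a T).card → ∃ k₀ : Fin 28, (∃ z : ℤ, bkpt a T (m + 1) * h28 a k₀ = z) ∧
      ∀ k, k ≠ k₀ → ∀ z : ℤ, bkpt a T (m + 1) * h28 a k ≠ z) :
    cuspSlope a T δ = 0 := by
  have hpos := h28_pos_of_openBox hopen
  obtain ⟨ρ, hρ, h1, h2, hgap⟩ := exists_admissible_scale hpos hT δ
  have hsym := cuspSlope_symm_nonneg_of_single_walls hpos hT hper δ hρ h1 h2 hgap hsingle
  have s1 := cuspSlope_nonpos_of_isLocalMax hopen hT hper δ hQ hreg hmax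
  have s2 := cuspSlope_nonpos_of_isLocalMax hopen hT hper (-δ) hQ hreg hmax
  linarith

end Summit.KontsevichZagierPeriods.Zeta5Search.Barrier.ConeGamma

end
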